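import Summits.QuantumFields.YangMills.Theorems.BalabanUVNodesN18BetaOfRecordBoxDegeneracyAx
import Summits.QuantumFields.YangMills.Theorems.BalabanUVNodesRateCarriersOfRecord13CoPHCmap

/-!
# BalabanUVNodes ∕ node N18 = NE5 — THE N18 PIN ROWS TYPED OVER THE CENTRE-MAP-GENERIC STAGE-13 RATE READING `RateReading₁₃CoPHCmap N Χ` (T1) AND ITS RE-CENTRED
# INSTANCE `RateReading₁₃CoPHAx N`: one-line readings of rows R14 ∕ R15's READING-FREE pin forms (`Thm/BalabanUVNodesN18U3GuardsAtKernelsAx` §2P,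
# `Thm/BalabanUVNodesN18BetaOfRecordBoxDegeneracyAx` §3P) at `X := (𝔯.lit F θ hP g₀ os).u3` — op 5c K3ᴬ supply rows R14∕R15, reading-typed editions

Cell `pub-ymgap`, seat `pub-ymgap-dag-n15-a` g38 (dag-lead WORDS 591∕592∕595 HANDS-4a rows R14∕R15; plan g99 `OP5C-SUPPLY-CENSUS-K3v8.md` §2 rows 14∕15 + σ5).
`--supports stmt-QuantumFields-27247` (K3ᴬ `SpineGivenEndpointR13SepCoPHVAx`) AS A HELPER — count-neutral; PROOF lane (0 `def`).

THE POINT.  The parents' §3 ∕ §3b pin forms bind `𝔯 : RateReading₁₃CoPH N` (provisos `θ.Provisos₁₃CoPH`, CHOICE-centred) and pin to `objectsOfRecord₁₃`; the K3ᴬ v8 skeleton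
binds a reading over the RE-CENTRED provisos `θ.Provisos₁₃CoPHAx` and pins to `objectsOfRecord₁₃Ax` (plan g99 σ4∕σ5).  Rows R14∕R15 landed the pin forms READING-FREE (any
`X : U3Objects₁₁` equal to the kernel objects); this module reads them at the centre-map-generic reading `RateReading₁₃CoPHCmap N Χ` of T1
(`Thm/BalabanUVNodesRateCarriersOfRecord13CoPHCmap`, dag-n15-c) — pinned at its OWN β-slot `Χ F θ` — and at the Ax instance, so that the skeleton's rows
`sensitive_rrOfRecord_of_pinned` ∕ `boxwiseConstant_of_pinned_blind` ∕ `sensitive_rrOfRecord_of_pinned_of_anchor` ∕ (l.720–722) are served BY NAME in the parents' binder shape.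

WHAT IS PROVED (all one term over R14 §2P ∕ R15 §3P).
* §1 centre-map-generic (`𝔯 : RateReading₁₃CoPHCmap N Χ`, `hpin : (𝔯.lit F θ hP g₀ os).u3 = objectsOfRecord₁₃Chi F N θ.toStage13Params (Χ F θ.toStage13Params) (ℓ F θ)`):
  ★★ `sensitiveOnBoxes_rateCarriersCmap_of_kernels_pin`, `boxwiseConstant_betaOfRecord₁₃Chi_of_blind_kernels_pin`,
  ★★ `sensitiveOnBoxes_rateCarriersCmap_of_kernels_pin_of_remainderNonvanishing`, `betaOfRecord₁₃Chi_eq_anchor_of_blind_kernels_pin`.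
* §2 re-centred (`𝔯 : RateReading₁₃CoPHAx N`, `hP : θ.Provisos₁₃CoPHAx F N`, pin at `objectsOfRecord₁₃Ax`, β `betaOfRecord₁₃Ax`): ★★ `sensitiveOnBoxes_rateCarriersAx_of_kernels_pin`,
  `boxwiseConstant_betaOfRecord₁₃Ax_of_blind_kernels_pin`, ★★ `sensitiveOnBoxes_rateCarriersAx_of_kernels_pin_of_remainderNonvanishing`, `betaOfRecord₁₃Ax_eq_anchor_of_blind_kernels_pin`.

HONEST FRAMING.  Count-neutral helper; one-line bookkeeping; nothing of Bałaban's asserted; β-non-degeneracy NOT proved (displayed hypothesis); NE5 ∕ (D4) NOT PRINTED for d = 4 ∕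
NOT proved; N18 NOT discharged; K3ᴬ OPEN, not claimed; counts UNMOVED (typed 28∕28 · discharged 8∕27 (A 8∕28)).  One finite four-torus programme at fixed `ε` — NOT ℝ⁴, NOT infinite
volume, NOT OS, NOT a mass gap, NOT Clay.  No `def`, no `sorry`.
-/

set_option autoImplicit false

noncomputable section

namespace YMDAG.N18.U3GuardsAtKernels

open Literature.MathematicalPhysics.QuantumFieldTheory.Balaban1983to89
open Literature.MathematicalPhysics.QuantumFieldTheory.Balaban1983to89.T4Continuum
open Literature.MathematicalPhysics.QuantumFieldTheory.Balaban1983to89.FlowStep (Box)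
open Literature.MathematicalPhysics.QuantumFieldTheory.Balaban1983to89.B12Beta (HistBox)
open Literature.MathematicalPhysics.QuantumFieldTheory.Balaban1983to89.Node00 (Stage13Params Stage13HParams ChiSlot betaOfRecord₁₃Chi betaOfRecord₁₃Ax chiβOfRecord₁₃Ax
  U3Letters₁₁)
open Literature.MathematicalPhysics.QuantumFieldTheory.Balaban1983to89.Node00.U3OfKernels (objectsOfRecord₁₃Chi objectsOfRecord₁₃Ax)
open YMDAG.UVSplit
open YMDAG.N18.U3Guards
open YMDAG.N18.BetaBoxDegeneracy (RemainderNonvanishingOnBoxes sensitiveOnBoxes_u3OfRecord₁₃_of_eq_objectsOfRecord₁₃Chi_of_remainderNonvanishing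
  betaOfRecord₁₃Chi_eq_anchor_of_blind_of_eq_objectsOfRecord₁₃Chi)

/-! ## §1 Centre-map-generic: `RateReading₁₃CoPHCmap N Χ` pinned to the kernel objects of record at its own β-slot `Χ F θ` -/

section PinnedCmap

variable {N : ℕ} [NeZero N] {Χ : (F : T4Family) → Stage13Params F N → ChiSlot F N} (𝔯 : RateReading₁₃CoPHCmap N Χ)
  (ℓ : (F : T4Family) → Stage13HParams F N → U3Letters₁₁)
  (hpin : ∀ (F : T4Family) (θ : Stage13HParams F N) (hP : θ.Provisos₁₃CoPHChi F N (Χ F θ.toStage13Params)) (g₀ : ℕ → ℝ) (os : List (ULoop F)),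
    (𝔯.lit F θ hP g₀ os).u3 = objectsOfRecord₁₃Chi F N θ.toStage13Params (Χ F θ.toStage13Params) (ℓ F θ))

include hpin in
/-- **★★ AT A CENTRE-MAP-GENERIC READING PINNED TO THE KERNEL OBJECTS AT ITS OWN β-SLOT, EVERY RUN-LENGTH BUNDLE PASSES THE GUARD AT EVERY TUPLE WHOSE
`betaOfRecord₁₃Chi … (Χ F θ…)` IS NOT BOXWISE CONSTANT** (R14 §2P at `X := (𝔯.lit F θ hP g₀ os).u3`). [folklore] -/
theorem sensitiveOnBoxes_rateCarriersCmap_of_kernels_pin (F : T4Family) (θ : Stage13HParams F N) (hP : θ.Provisos₁₃CoPHChi F N (Χ F θ.toStage13Params))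
    (hβ : ¬ BoxwiseConstant θ.γ (betaOfRecord₁₃Chi F N θ.toStage13Params (Χ F θ.toStage13Params))) (g₀ : ℕ → ℝ) (os : List (ULoop F)) (k : ℕ) :
    SensitiveOnBoxes (rateCarriersOfRecord₁₃CoPHCmap 𝔯 F θ hP g₀ os k).u3.EA θ.γ :=
  sensitiveOnBoxes_u3OfRecord₁₃_of_eq_objectsOfRecord₁₃Chi' θ.toStage13Params (Χ F θ.toStage13Params) (ℓ F θ) (hpin F θ hP g₀ os) hβ k

include hpin in
/-- … conversely, a BLIND run-length bundle of the pinned reading forces `betaOfRecord₁₃Chi … (Χ F θ…)` boxwise constant at that tuple (R14 §2P). [folklore] -/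
theorem boxwiseConstant_betaOfRecord₁₃Chi_of_blind_kernels_pin (F : T4Family) (θ : Stage13HParams F N) (hP : θ.Provisos₁₃CoPHChi F N (Χ F θ.toStage13Params))
    (g₀ : ℕ → ℝ) (os : List (ULoop F)) (k : ℕ) (h : BlindOnBoxes (rateCarriersOfRecord₁₃CoPHCmap 𝔯 F θ hP g₀ os k).u3.EA θ.γ) :
    BoxwiseConstant θ.γ (betaOfRecord₁₃Chi F N θ.toStage13Params (Χ F θ.toStage13Params)) :=
  boxwiseConstant_betaOfRecord₁₃Chi_of_blind_of_eq_objectsOfRecord₁₃Chi θ.toStage13Params (Χ F θ.toStage13Params) (ℓ F θ) (hpin F θ hP g₀ os) k h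

include hpin in
/-- **★★ `KeyedSensitive`'s CONCLUSION FROM THE ANCHOR + THE MISSING LETTER** at the centre-map-generic pinned reading (R15 §3P). [folklore] -/
theorem sensitiveOnBoxes_rateCarriersCmap_of_kernels_pin_of_remainderNonvanishing (F : T4Family) (θ : Stage13HParams F N)
    (hP : θ.Provisos₁₃CoPHChi F N (Χ F θ.toStage13Params)) {b : ℕ → ℝ}
    (hA : ∀ (k : ℕ) (δ : ℝ), 0 < δ → ∃ γ' : ℝ, 0 < γ' ∧ ∀ p : Fin (k + 1) → ℝ, p ∈ HistBox γ' k →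
      |betaOfRecord₁₃Chi F N θ.toStage13Params (Χ F θ.toStage13Params) k p - b k| ≤ δ)
    (hnv : RemainderNonvanishingOnBoxes θ.γ (betaOfRecord₁₃Chi F N θ.toStage13Params (Χ F θ.toStage13Params)) b) (g₀ : ℕ → ℝ) (os : List (ULoop F)) (k : ℕ) :
    SensitiveOnBoxes (rateCarriersOfRecord₁₃CoPHCmap 𝔯 F θ hP g₀ os k).u3.EA θ.γ :=
  sensitiveOnBoxes_u3OfRecord₁₃_of_eq_objectsOfRecord₁₃Chi_of_remainderNonvanishing θ.toStage13Params (Χ F θ.toStage13Params) (ℓ F θ) (hpin F θ hP g₀ os) hA hnv k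

include hpin in
/-- **THE FAILURE MODE UNDER THE PIN, READ THROUGH THE ANCHOR** at the centre-map-generic pinned reading (R15 §3P). [folklore] -/
theorem betaOfRecord₁₃Chi_eq_anchor_of_blind_kernels_pin (F : T4Family) (θ : Stage13HParams F N) (hP : θ.Provisos₁₃CoPHChi F N (Χ F θ.toStage13Params)) {b : ℕ → ℝ}
    (hA : ∀ (k : ℕ) (δ : ℝ), 0 < δ → ∃ γ' : ℝ, 0 < γ' ∧ ∀ p : Fin (k + 1) → ℝ, p ∈ HistBox γ' k →
      |betaOfRecord₁₃Chi F N θ.toStage13Params (Χ F θ.toStage13Params) k p - b k| ≤ δ)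
    (g₀ : ℕ → ℝ) (os : List (ULoop F)) (k : ℕ) (h : BlindOnBoxes (rateCarriersOfRecord₁₃CoPHCmap 𝔯 F θ hP g₀ os k).u3.EA θ.γ)
    (k' : ℕ) (v : Fin (k' + 1) → ℝ) (hv : v ∈ Box θ.γ k') : betaOfRecord₁₃Chi F N θ.toStage13Params (Χ F θ.toStage13Params) k' v = b k' :=
  betaOfRecord₁₃Chi_eq_anchor_of_blind_of_eq_objectsOfRecord₁₃Chi θ.toStage13Params (Χ F θ.toStage13Params) (ℓ F θ) (hpin F θ hP g₀ os) hA k h k' v hv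

end PinnedCmap

/-! ## §2 Re-centred: `RateReading₁₃CoPHAx N` pinned to `objectsOfRecord₁₃Ax` (the K3ᴬ v8 `U3PinnedKernels` after plan g99's σ5) -/

section PinnedAx

variable {N : ℕ} [NeZero N] (𝔯 : RateReading₁₃CoPHAx N) (ℓ : (F : T4Family) → Stage13HParams F N → U3Letters₁₁)
  (hpin : ∀ (F : T4Family) (θ : Stage13HParams F N) (hP : θ.Provisos₁₃CoPHAx F N) (g₀ : ℕ → ℝ) (os : List (ULoop F)),
    (𝔯.lit F θ hP g₀ os).u3 = objectsOfRecord₁₃Ax F N θ.toStage13Params (ℓ F θ))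

include hpin in
/-- **★★ THE K3ᴬ v8 ROW `sensitive_rrOfRecord_of_pinned` BY NAME**: at a reading of the re-centred record pinned to the re-centred kernel objects, every run-length bundle
passes the guard at every tuple whose `betaOfRecord₁₃Ax` is not boxwise constant. [folklore] -/
theorem sensitiveOnBoxes_rateCarriersAx_of_kernels_pin (F : T4Family) (θ : Stage13HParams F N) (hP : θ.Provisos₁₃CoPHAx F N)
    (hβ : ¬ BoxwiseConstant θ.γ (betaOfRecord₁₃Ax F N θ.toStage13Params)) (g₀ : ℕ → ℝ) (os : List (ULoop F)) (k : ℕ) :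
    SensitiveOnBoxes (rateCarriersOfRecord₁₃CoPHCmap 𝔯 F θ hP g₀ os k).u3.EA θ.γ :=
  sensitiveOnBoxes_rateCarriersCmap_of_kernels_pin 𝔯 ℓ hpin F θ hP hβ g₀ os k

include hpin in
/-- **THE K3ᴬ v8 ROW `boxwiseConstant_of_pinned_blind` BY NAME**: a BLIND run-length bundle of the pinned re-centred reading forces `betaOfRecord₁₃Ax` boxwise constant. [folklore] -/
theorem boxwiseConstant_betaOfRecord₁₃Ax_of_blind_kernels_pin (F : T4Family) (θ : Stage13HParams F N) (hP : θ.Provisos₁₃CoPHAx F N) (g₀ : ℕ → ℝ)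
    (os : List (ULoop F)) (k : ℕ) (h : BlindOnBoxes (rateCarriersOfRecord₁₃CoPHCmap 𝔯 F θ hP g₀ os k).u3.EA θ.γ) :
    BoxwiseConstant θ.γ (betaOfRecord₁₃Ax F N θ.toStage13Params) :=
  boxwiseConstant_betaOfRecord₁₃Chi_of_blind_kernels_pin 𝔯 ℓ hpin F θ hP g₀ os k h

include hpin in
/-- **THE K3ᴬ v8 ROW `sensitive_rrOfRecord_of_pinned_of_anchor` BY NAME**: anchor + missing letter for `betaOfRecord₁₃Ax` ⇒ every run-length bundle passes the guard. [folklore] -/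
theorem sensitiveOnBoxes_rateCarriersAx_of_kernels_pin_of_remainderNonvanishing (F : T4Family) (θ : Stage13HParams F N) (hP : θ.Provisos₁₃CoPHAx F N) {b : ℕ → ℝ}
    (hA : ∀ (k : ℕ) (δ : ℝ), 0 < δ → ∃ γ' : ℝ, 0 < γ' ∧ ∀ p : Fin (k + 1) → ℝ, p ∈ HistBox γ' k → |betaOfRecord₁₃Ax F N θ.toStage13Params k p - b k| ≤ δ)
    (hnv : RemainderNonvanishingOnBoxes θ.γ (betaOfRecord₁₃Ax F N θ.toStage13Params) b) (g₀ : ℕ → ℝ) (os : List (ULoop F)) (k : ℕ) :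
    SensitiveOnBoxes (rateCarriersOfRecord₁₃CoPHCmap 𝔯 F θ hP g₀ os k).u3.EA θ.γ :=
  sensitiveOnBoxes_rateCarriersCmap_of_kernels_pin_of_remainderNonvanishing 𝔯 ℓ hpin F θ hP hA hnv g₀ os k

include hpin in
/-- **THE K3ᴬ v8 ROW AT PROBE l.720–722 BY NAME**: a BLIND run-length bundle forces `betaOfRecord₁₃Ax … k' v = b k'` on every box. [folklore] -/
theorem betaOfRecord₁₃Ax_eq_anchor_of_blind_kernels_pin (F : T4Family) (θ : Stage13HParams F N) (hP : θ.Provisos₁₃CoPHAx F N) {b : ℕ → ℝ}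
    (hA : ∀ (k : ℕ) (δ : ℝ), 0 < δ → ∃ γ' : ℝ, 0 < γ' ∧ ∀ p : Fin (k + 1) → ℝ, p ∈ HistBox γ' k → |betaOfRecord₁₃Ax F N θ.toStage13Params k p - b k| ≤ δ)
    (g₀ : ℕ → ℝ) (os : List (ULoop F)) (k : ℕ) (h : BlindOnBoxes (rateCarriersOfRecord₁₃CoPHCmap 𝔯 F θ hP g₀ os k).u3.EA θ.γ)
    (k' : ℕ) (v : Fin (k' + 1) → ℝ) (hv : v ∈ Box θ.γ k') : betaOfRecord₁₃Ax F N θ.toStage13Params k' v = b k' :=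
  betaOfRecord₁₃Chi_eq_anchor_of_blind_kernels_pin 𝔯 ℓ hpin F θ hP hA g₀ os k h k' v hv

end PinnedAx

end YMDAG.N18.U3GuardsAtKernels

end
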